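import Mathlib
import Summits.CriticalPhenomena.PercolationContinuityZ3.Theorems.PercNearOneGluingNoHeavyLowerTailLogCM
import Summits.CriticalPhenomena.PercolationContinuityZ3.Theorems.PercNearOneGluingNoHeavyLowerTailRegionII
import HarnessLib

/-!
# THEOREM Φ for EVERY `θ > 0` at EVERY level: `1/₂F₁(−θ,−m;c;g)` is log-completely-monotone

Support file for the Sahi / Conjecture-P programme of route `PercNearOneGluingNoHeavy`
(`--supports stmt-CriticalPhenomena-4575`, prover prim-l12-p5 gen 42; proof note
`prim-l12-p5/PROOF-REGION-II-KUMMER-REFLECTION-g41.md` (2.3)).  No definitions, no named facts, no sorries.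

`…LowerTailLogCM` proved THEOREM Φ (`Δ_m log Q_θ(m)` completely monotone, `Q_θ(m) = ₂F₁(−θ,−m;c;g)`) for `θ ≤ 2` at every level
and for all `θ` in Region I (`c ≥ 1 − θ₀`), plus the induction step `Φ(θ) ∧ ρ_θ CM ⟹ Φ(θ+1)`.  In the strip `c < 1 − θ₀` the missing
input `ρ_θ` CM for `θ = θ₀ + 1 + n` is THEOREM RII (`hyp_inv_ratio_altSum_regionII`, g41).  Hence:

* **`hyp_logDiff_altSum_nonneg_all`** — for every `θ = θ₀ + n > 0` (`θ₀ ∈ (0,1]`, `n ∈ ℕ`), every `c > 0`, `0 ≤ g < 1`: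
  `m ↦ log ₂F₁(−θ,−(m+1);c;g) − log ₂F₁(−θ,−m;c;g)` is completely monotone (CONJECTURE Φ of g39 in full; in the birth–death
  language, `i ↦ −log E[e^{−sT_{i→i+1}}]` is completely monotone in the level `i` for every killing rate).
-/

namespace Summit.CriticalPhenomena.PercolationContinuityZ3.Theorems

namespace HypergeomCM

open Finset MomentRatioTN
open scoped Nat

section

variable (g : ℝ) (H : ℝ → ℝ → ℕ → ℝ)
  (hH : ∀ a c r, H a c r = ∑ k ∈ range (r + 1), (r.choose k : ℝ) * (-g) ^ k *
    ((∏ i ∈ range k, (a + i)) / (∏ i ∈ range k, (c + i))))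
include hH

/-- **THEOREM Φ (all θ, all levels).**  For `θ = θ₀ + n` (`0 < θ₀ ≤ 1`, `n ∈ ℕ`), `c > 0`, `0 ≤ g < 1`:
`m ↦ log H (−θ) c (m+1) − log H (−θ) c m` is completely monotone. -/
theorem hyp_logDiff_altSum_nonneg_all (hg0 : 0 ≤ g) (hg1 : g < 1) (c : ℝ) (hc : 0 < c) (θ₀ : ℝ)
    (h0 : 0 < θ₀) (h1 : θ₀ ≤ 1) (n : ℕ) (k j : ℕ) :
    0 ≤ ∑ i ∈ range (k + 1), (-1 : ℝ) ^ i * (k.choose i : ℝ) *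
      (Real.log (H (-(θ₀ + n)) c (j + i + 1)) - Real.log (H (-(θ₀ + n)) c (j + i))) := by
  rcases le_or_gt (1 - θ₀) c with hI | hII
  · exact hyp_logDiff_altSum_nonneg_regionI g H hH hg0 hg1 c hc θ₀ h0 h1 hI n k j
  · -- the strip c < 1 − θ₀: θ₀ directly, then θ₀ + 1 + m by induction on m with RII supplying ρ
    cases n with
    | zero =>
      simp only [Nat.cast_zero, add_zero]
      exact hyp_logDiff_altSum_nonneg_le_one g H hH hg0 hg1 c hc θ₀ h0 h1 k j
    | succ m =>
      have key : ∀ m : ℕ, ∀ k j, 0 ≤ ∑ i ∈ range (k + 1), (-1 : ℝ) ^ i * (k.choose i : ℝ) *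
          (Real.log (H (-(θ₀ + 1 + m)) c (j + i + 1)) - Real.log (H (-(θ₀ + 1 + m)) c (j + i))) := by
        intro m
        induction m with
        | zero =>
          intro k j
          have h := hyp_logDiff_altSum_nonneg_le_two g H hH hg0 hg1 c hc θ₀ h0 h1 k j
          have e1 : -θ₀ - 1 = -(θ₀ + 1 + ((0 : ℕ) : ℝ)) := by push_cast; ring
          rw [e1] at h
          exact h
        | succ m ih =>
          intro k j
          have hρ := (hyp_inv_ratio_altSum_regionII g H hH hg0 hg1 c hc θ₀ h0 (by linarith) m).2
          have hstep := hyp_logDiff_step g H hH hg0 hg1 c hc (θ₀ + 1 + m) (by positivity) hρ ih k j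
          have e1 : -(θ₀ + 1 + (m : ℝ)) - 1 = -(θ₀ + 1 + ((m + 1 : ℕ) : ℝ)) := by push_cast; ring
          rw [e1] at hstep
          exact hstep
      have h := key m k j
      have e2 : -(θ₀ + 1 + (m : ℝ)) = -(θ₀ + ((m + 1 : ℕ) : ℝ)) := by push_cast; ring
      rw [e2] at h
      exact h

end

end HypergeomCM

end Summit.CriticalPhenomena.PercolationContinuityZ3.Theorems
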